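import Literature.NumberTheory.GaloisRepresentations.ContinuousH1TorsionOfInjectiveEndomorphism
import HarnessLib

/-!
# Restriction along `ι : H →ₜ* G` commutes with `H¹(e)` for an endomorphism `e : X ⟶ X`
# (Greenberg 2010 §2.1, the commutative square behind (8)), on explicit continuous cocycles

Topic `NumberTheory/GaloisRepresentations`; namespace `Literature.NumberTheory.GaloisRepresentations`.
THEOREMS ONLY (no definition, no named fact, no `sorry`). Seat `bsd-line-x1-p1-w5` gen 9 (cell
`bsd-eis`), glue for brick C4 (Greenberg 2010 Prop. 2.3.2) of the road «SUR-Λ» toward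
`Greenberg2016.prop263_sur_of_crk_caseC_tc` (crux 2 `GoodLatticeBDPValue`, stmt-BirchSwinnertonDyer-19032).

PRINT. R. Greenberg, Kyoto J. Math. 50 (2010), §2.1 p. 8 L1–8: "Thus, for any nonzero element `θ` in
`Λ`, the horizontal maps in the following commutative diagram are isomorphisms
[`H⁰(K, T*/θT*) → H¹(K, T*)[θ]` over `H⁰(K_η, T*/θT*) → H¹(K_η, T*)[θ]`]. The first vertical map is
injective. Hence so is the second."  The vertical maps are the restrictions `Γ_{K_η} → Γ_K`; that the
square with multiplication by `θ` (here: any equivariant endomorphism `e`, acting on `H¹` by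
`cohomologyMap e 1`, and on the restricted representation by `(resFunctor ι).map e`) COMMUTES is what
lets a `θ`-torsion class of `H¹(K, T*)` restrict to a `θ`-torsion class of `H¹(K_η, T*)` — the input of
(8) used in Prop. 2.3.2.

* `map_cohomologyMap_one_eq` — `Res_ι (H¹(e) y) = H¹(e|_H) (Res_ι y)` in `H¹_cont(H, Res_ι X)`.
* `map_eq_zero_of_cohomologyMap` corollaries: `H¹(e) y = 0 → H¹(e|_H)(Res_ι y) = 0`; the family form.

HONEST FRAMING: generic cocycle algebra; nothing summit-side; no case of BSD. AI-typed, kernel-checked.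

## References
* [Greenberg2010] R. Greenberg, Kyoto J. Math. 50 (2010), doi:10.1215/0023608x-2010-016 — §2.1 p. 8 L1–10 (the square behind (8)).
-/

noncomputable section

open CategoryTheory

universe u v

namespace Literature.NumberTheory.GaloisRepresentations

open TopRep ContinuousCohomology

variable {k : Type u} [CommRing k] [TopologicalSpace k]
variable {G : Type v} [Group G] [TopologicalSpace G] [IsTopologicalGroup G]
variable {H : Type v} [Group H] [TopologicalSpace H] [IsTopologicalGroup H]
variable (X : TopRep.{v} k G)

/-- **The restriction square commutes**: for `ι : H →ₜ* G` and an endomorphism `e : X ⟶ X`,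
`Res_ι (H¹(e) y) = H¹(e|_H) (Res_ι y)`, where `Res_ι = ContinuousCohomology.map ι (𝟙 (res ι X)) 1` and
`e|_H = (resFunctor ι).map e`. Both sides are the class of `h ↦ e (φ (ι h))`.
[cite: Greenberg2010, §2.1 p. 8 L1–8 (the commutative square)] -/
theorem map_cohomologyMap_one_eq (ι : H →ₜ* G) (e : X ⟶ X) (y : continuousCohomology 1 X) :
    ContinuousCohomology.map ι (𝟙 (res (ι : H →* G) X)) 1 (cohomologyMap e 1 y) =
      cohomologyMap ((resFunctor (ι : H →* G)).map e) 1
        (ContinuousCohomology.map ι (𝟙 (res (ι : H →* G) X)) 1 y) := by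
  obtain ⟨φ, rfl⟩ := oneCocycleClass_surjective X y
  rw [cohomologyMap_oneCocycleClass, map_oneCocycleClass, map_oneCocycleClass,
    cohomologyMap_oneCocycleClass]
  congr 1

/-- Corollary: a class killed by `H¹(e)` restricts to a class killed by `H¹(e|_H)`.
[cite: Greenberg2010, §2.1 p. 8 L1–10] -/
theorem cohomologyMap_map_eq_zero_of_cohomologyMap_eq_zero (ι : H →ₜ* G) (e : X ⟶ X)
    (y : continuousCohomology 1 X) (hy : cohomologyMap e 1 y = 0) :
    cohomologyMap ((resFunctor (ι : H →* G)).map e) 1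
        (ContinuousCohomology.map ι (𝟙 (res (ι : H →* G) X)) 1 y) = 0 := by
  rw [← map_cohomologyMap_one_eq, hy, map_zero]

omit [IsTopologicalGroup G] [IsTopologicalGroup H] in
/-- The restricted endomorphism acts by `e`: `((resFunctor ι).map e).hom x = e.hom x`.
[cite: Greenberg2010, §2.1 p. 8 L1–8] -/
theorem resFunctor_map_hom_apply (ι : H →ₜ* G) (e : X ⟶ X) (x : X) :
    ((resFunctor (ι : H →* G)).map e).hom x = e.hom x := rfl

omit [IsTopologicalGroup G] [IsTopologicalGroup H] in
/-- The restricted endomorphism is injective when `e` is. [cite: Greenberg2010, §2.1 p. 8 L1–8] -/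
theorem resFunctor_map_injective (ι : H →ₜ* G) (e : X ⟶ X) (he : Function.Injective e.hom) :
    Function.Injective ((resFunctor (ι : H →* G)).map e).hom := fun _ _ hab => he hab

end Literature.NumberTheory.GaloisRepresentations

end
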